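import Summits.QuantumFields.YangMills.Theorems.QuantileBitPurityGAxisDomination
import Summits.QuantumFields.YangMills.Theorems.ToronSmallBallOwnAxisShiftDominationGen
import HarnessLib

/-!
# The seam-axis sheet shift sends the core of the periodic sector into a CONSTANT-CENTRE ANNULUS

Support module (`--supports` stmt-QuantumFields-24080, `FluxSectorLaplace.PeriodicCoreRaritySubQuartic`; seat ym-dw-p1 g17).  Refinement of
`GAxis.sectorWeight_coreGood_le` (seat g16): the reference rotation `h₀ = exp(ι θ · axis)` of the seam-axis sheet shift has distance to the centre
EXACTLY `v(θ) = √(4 − 4|cos θ|)` whatever the (configuration-dependent) axis, so the shift maps the slice-`0` core `{polDist U₀ ≤ r}` into the annulus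
`{|polDist U₀ − v(θ)| ≤ r}` — an off-core strip with constant centre, inner radius `> (4/3)θ − 2r`, which the own-axis translate estimate can then
price.  With the bad-field floor bound this gives

★ `sectorWeight_core_le_exp_mul_annulus_add`: in the untwisted seam sector of a ring of `n + 1 ≤ 2L` slices,
`W₀(𝟙{polDist U₀ ≤ r}) ≤ e^{Q} · W₀(𝟙{|polDist U₀ − v(θ)| ≤ r ∧ (4/3)θ − 2r < polDist U₀}) + W₀(𝟙_{bad})`,
and ★ `sectorWeight_core_le_annulus_of_numerics`: with `θ = β^(−13/40)`, `r = β^(−2/5)`, `χ₀ = σ₁ = β^(−1/4)`, `η = β^(−19/40)` and two numeric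
inequalities (`Q ≤ 1`, bad fields `≤ β^(−a)/2`), `W₀(core) ≤ e · W₀(annulus) + (β^(−a)/2) · Z_phys`.

HONEST FRAMING: fixed-lattice inequalities in one seam sector; nothing about infinite volume, the continuum or the Clay gap.  No `sorry`, no new axiom,
no new definition.  References: [cite: Luscher1983, §2]; [cite: MontvayMunster1994, (3.145)]; [cite: tHooft1979].
-/

set_option autoImplicit false

noncomputable section

open MeasureTheory Set Function
open scoped BigOperators
open Literature.MathematicalPhysics.QuantumLattice (su2Quat su2Quat_ne_zero norm_su2Quat)
open Literature.MathematicalPhysics.QuantumFieldTheory hiding su2Quat_mul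
open Literature.MathematicalPhysics.QuantumFieldTheory.Balaban1983to89.T4HaarSU2ExpChart (expPoint)

namespace Summit.QuantumFields.YangMills.Theorems.FemtoTransferGap.GAxis

open ClassShift FlatSheet OwnAxis
open Summit.QuantumFields.YangMills.Theorems.FemtoTransferGap.TT

variable {L : ℕ}

/-! ## §1 The size of the reference rotation is a function of the angle alone -/

/-- ★ `vacDist h₀ = √(4 − 4|cos θ|)` for the reference rotation of angle `θ` (any axis chosen by the axis rule). [folklore] -/
theorem vacDist_gAxisElt_eq (θ : ℝ) {χ₀ σ₁ : ℝ} (hχ : 0 < χ₀) (hσ : 0 < σ₁) (g : Site 3 L → SU2) (U : GaugeConfig 3 L SU2) :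
    vacDist (gAxisElt θ χ₀ σ₁ g U) = Real.sqrt (4 - 4 * |Real.cos θ|) := by
  have hn : ‖θ • gAxis χ₀ σ₁ (g 0) (lineHolonomy U 1 L 0) (lineHolonomy U 2 L 0)‖ = |θ| := by
    rw [norm_smul, norm_gAxis_eq_one hχ hσ, mul_one, Real.norm_eq_abs]
  have hsq := vacDist_expPoint_sq (θ • gAxis χ₀ σ₁ (g 0) (lineHolonomy U 1 L 0) (lineHolonomy U 2 L 0))
  rw [hn, Real.cos_abs] at hsq
  rw [gAxisElt_def, ← hsq, Real.sqrt_sq (vacDist_nonneg _)]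

variable [NeZero L]

/-! ## §2 One shift dominates the good part of the core by the annulus -/

/-- ★ **Core → annulus domination.**  For `β ≥ 0`, `t ≥ 0`, `χ₀, σ₁ > 0`, `0 ≤ θ ≤ 1` and any core radius `r`:
`W₀(𝟙_{goodEvent ∩ {polDist U₀ ≤ r}}) ≤ e^{Q} · W₀(𝟙{|polDist U₀ − √(4 − 4|cos θ|)| ≤ r ∧ (4/3)θ − 2r < polDist U₀})`, `Q` the exponent of
`seamDensity_le_exp_mul_gAxisShift`. [cite: Luscher1983, §2] [cite: MontvayMunster1994, (3.145)] -/
theorem sectorWeight_coreGood_le_annulus {β : ℝ} (hβ : 0 ≤ β) (n : ℕ) {s t r θ χ₀ σ₁ : ℝ} (ht : 0 ≤ t) (hχ : 0 < χ₀) (hσ : 0 < σ₁)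
    (hθ0 : 0 ≤ θ) (hθ1 : θ ≤ 1) (hr : 0 < r) :
    sectorWeight β n (fun _ => false) (fun Us g =>
        {p : (Site 3 L → SU2) × (Fin (n + 1) → GaugeConfig 3 L SU2) | p ∈ goodEvent n (fun _ => false) s t ∧ polDist (p.2 0) ≤ r}.indicator
          (fun _ => (1 : ℝ)) (g, Us)) ≤
      Real.exp (β * ((n + 1 : ℕ) * (Fintype.card (Plaquette 3 L) *
            ((|θ| * (L * ((n + 1 : ℕ) * t) / χ₀ + L * (L * Real.sqrt s) / σ₁ + 2 * σ₁) + 2 * (L * (L * Real.sqrt s)) * |θ| + 2 * (n * t) * |θ|) ^ 2 +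
              2 * (|θ| * (L * ((n + 1 : ℕ) * t) / χ₀ + L * (L * Real.sqrt s) / σ₁ + 2 * σ₁) + 2 * (L * (L * Real.sqrt s)) * |θ| + 2 * (n * t) * |θ|) * Real.sqrt s)) +
          Fintype.card (Edge 3 L) * ((2 * χ₀ * |θ| + 4 * (L * ((n + 1 : ℕ) * t)) * |θ|) ^ 2 + 2 * (2 * χ₀ * |θ| + 4 * (L * ((n + 1 : ℕ) * t)) * |θ|) * t))) *
      sectorWeight β n (fun _ => false) (fun Us _ =>
        {U : GaugeConfig 3 L SU2 | |polDist U - (fun _ : GaugeConfig 3 L SU2 => Real.sqrt (4 - 4 * |Real.cos θ|)) U| ≤ r ∧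
          4 / 3 * θ - 2 * r < polDist U}.indicator (fun _ => (1 : ℝ)) (Us 0)) := by
  have hproj : Measurable fun p : (Site 3 L → SU2) × (Fin (n + 1) → GaugeConfig 3 L SU2) => p.2 0 := (measurable_pi_apply 0).comp measurable_snd
  have hpd : Measurable fun p : (Site 3 L → SU2) × (Fin (n + 1) → GaugeConfig 3 L SU2) => polDist (p.2 0) := measurable_polDist.comp hproj
  have hA : MeasurableSet {p : (Site 3 L → SU2) × (Fin (n + 1) → GaugeConfig 3 L SU2) | p ∈ goodEvent n (fun _ => false) s t ∧ polDist (p.2 0) ≤ r} := by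
    have h1 : MeasurableSet {p : (Site 3 L → SU2) × (Fin (n + 1) → GaugeConfig 3 L SU2) | p ∈ goodEvent n (fun _ => false) s t} :=
      measurableSet_goodEvent (L := L) n _ s t
    have h2 : MeasurableSet {p : (Site 3 L → SU2) × (Fin (n + 1) → GaugeConfig 3 L SU2) | polDist (p.2 0) ≤ r} := measurableSet_le hpd measurable_const
    rw [measurableSet_setOf] at h1 h2 ⊢
    exact h1.and h2
  set S : Set (GaugeConfig 3 L SU2) := {U : GaugeConfig 3 L SU2 |
    |polDist U - (fun _ : GaugeConfig 3 L SU2 => Real.sqrt (4 - 4 * |Real.cos θ|)) U| ≤ r ∧ 4 / 3 * θ - 2 * r < polDist U} with hS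
  have hSm : MeasurableSet S := measurableSet_stripGen (L := L) measurable_const _ _
  have hB : MeasurableSet {p : (Site 3 L → SU2) × (Fin (n + 1) → GaugeConfig 3 L SU2) | p.2 0 ∈ S} := hproj hSm
  have hBeq : (fun (Us : Fin (n + 1) → GaugeConfig 3 L SU2) (_ : Site 3 L → SU2) => S.indicator (fun _ => (1 : ℝ)) (Us 0)) =
      fun Us g => {p : (Site 3 L → SU2) × (Fin (n + 1) → GaugeConfig 3 L SU2) | p.2 0 ∈ S}.indicator (fun _ => (1 : ℝ)) (g, Us) := by
    funext Us g
    by_cases h : Us 0 ∈ S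
    · rw [Set.indicator_of_mem h, Set.indicator_of_mem (show ((g, Us) : (Site 3 L → SU2) × (Fin (n + 1) → GaugeConfig 3 L SU2)) ∈
        {p : (Site 3 L → SU2) × (Fin (n + 1) → GaugeConfig 3 L SU2) | p.2 0 ∈ S} from h)]
    · rw [Set.indicator_of_notMem h, Set.indicator_of_notMem (show ((g, Us) : (Site 3 L → SU2) × (Fin (n + 1) → GaugeConfig 3 L SU2)) ∉
        {p : (Site 3 L → SU2) × (Fin (n + 1) → GaugeConfig 3 L SU2) | p.2 0 ∈ S} from h)]
  rw [hBeq]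
  refine sectorWeight_indicator_le_of_translate (L := L) β n (fun _ => false) (measurable_gAxisShift_uncurry θ χ₀ σ₁ n)
    (fun g => measurePreserving_gAxisShift θ χ₀ σ₁ g n) hA hB ?_ (Real.exp_pos _).le ?_
  · -- the image lies in the annulus
    rintro p ⟨-, hcore⟩
    simp only [Set.mem_setOf_eq, gAxisShift_apply, hS]
    have h1 := abs_polDist_siteTwist_zero_sub_le (gAxisField θ χ₀ σ₁ p.1 (p.2 0)) (p.2 0)
    rw [gAxisField_zero] at h1
    have h2 := vacDist_gAxisElt_ge hθ0 hθ1 hχ hσ p.1 (p.2 0)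
    have hv := vacDist_gAxisElt_eq θ hχ hσ p.1 (p.2 0)
    rw [hv] at h1 h2
    refine ⟨h1.trans hcore, ?_⟩
    have h3 := (abs_le.1 h1).1
    have h0 : 0 ≤ polDist (p.2 0) := polDist_nonneg _
    linarith
  · -- the cost
    rintro p ⟨hgood, -⟩
    exact seamDensity_le_exp_mul_gAxisShift hβ θ hχ hσ ht hgood

/-! ## §3 Bookkeeping with the bad fields and the numeric form -/

/-- ★ **Core ≤ e^Q · annulus + bad fields** (`W₀(𝟙_core) ≤ W₀(𝟙_{good ∩ core}) + W₀(𝟙_{goodᶜ})` and §2). [cite: Luscher1983, §2] -/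
theorem sectorWeight_core_le_exp_mul_annulus_add {β : ℝ} (hβ : 0 ≤ β) (n : ℕ) {s t r θ χ₀ σ₁ : ℝ} (ht : 0 ≤ t) (hχ : 0 < χ₀) (hσ : 0 < σ₁)
    (hθ0 : 0 ≤ θ) (hθ1 : θ ≤ 1) (hr : 0 < r) :
    sectorWeight β n (fun _ => false) (fun Us _ => {U : GaugeConfig 3 L SU2 | polDist U ≤ r}.indicator (fun _ => (1 : ℝ)) (Us 0)) ≤
      Real.exp (β * ((n + 1 : ℕ) * (Fintype.card (Plaquette 3 L) *
            ((|θ| * (L * ((n + 1 : ℕ) * t) / χ₀ + L * (L * Real.sqrt s) / σ₁ + 2 * σ₁) + 2 * (L * (L * Real.sqrt s)) * |θ| + 2 * (n * t) * |θ|) ^ 2 +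
              2 * (|θ| * (L * ((n + 1 : ℕ) * t) / χ₀ + L * (L * Real.sqrt s) / σ₁ + 2 * σ₁) + 2 * (L * (L * Real.sqrt s)) * |θ| + 2 * (n * t) * |θ|) * Real.sqrt s)) +
          Fintype.card (Edge 3 L) * ((2 * χ₀ * |θ| + 4 * (L * ((n + 1 : ℕ) * t)) * |θ|) ^ 2 + 2 * (2 * χ₀ * |θ| + 4 * (L * ((n + 1 : ℕ) * t)) * |θ|) * t))) *
      sectorWeight β n (fun _ => false) (fun Us _ =>
        {U : GaugeConfig 3 L SU2 | |polDist U - (fun _ : GaugeConfig 3 L SU2 => Real.sqrt (4 - 4 * |Real.cos θ|)) U| ≤ r ∧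
          4 / 3 * θ - 2 * r < polDist U}.indicator (fun _ => (1 : ℝ)) (Us 0)) +
      sectorWeight β n (fun _ => false) (fun Us g => (goodEvent (L := L) n (fun _ => false) s t)ᶜ.indicator (fun _ => (1 : ℝ)) (g, Us)) :=
  (sectorWeight_core_le_add (L := L) β n s t r).trans (add_le_add (sectorWeight_coreGood_le_annulus hβ n ht hχ hσ hθ0 hθ1 hr) le_rfl)

end Summit.QuantumFields.YangMills.Theorems.FemtoTransferGap.GAxis

end
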